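import Summits.CriticalPhenomena.PercolationContinuityZ3.Theorems.SahiMasterFamilyPointwisePrincipalCapSix

/-!
# Absorbing extensions: pointwise (EQ) and `C_k` pass from `U_{−j}` to `U` when `U_j` contains every other member — orders up to SEVEN

Unit `prim-master-conj` (crux anchor stmt-CriticalPhenomena-4575, helper work), gen 13.  If a member `U_j` of a family of `n+3 ≥ 3` increasing events
contains all the others ("absorbing member"), then for EVERY finite measure `E_{n+3}(1_U) = ((n+2) − μ(U_j))·E_{n+2}(1_{U_{−j}})`
(`sahiE_ind_eq_of_absorbing`, gen 9) with a positive factor, and `U ∈ Z_{n+3} ↔ U_{−j} ∈ Z_{n+2}` (`Pointwise.suppZeroFlag_iff_erase_of_absorbing`,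
this generation).  Hence at every parameter `p` (law level, no interiority needed for the transfer itself):
* `sahiE_ind_eq_zero_iff_erase_of_absorbing`, `sahiE_ind_nonneg_iff_erase_of_absorbing`, `sahiE_ind_pos_iff_erase_of_absorbing`;
* `pointwise_iff_erase_of_absorbing` — **the pointwise statement `E(μ_p;1_U) = 0 ↔ U ∈ Z` holds for `U` iff it holds for `U_{−j}`**;
so every class on which the pointwise master conjecture / `C_k` is settled is closed under absorbing extensions, one order up.  Headline instance
(`…_of_absorbing_faceVanishing_of_le_six`): **a family of `k+1 ≤ 7` increasing events consisting of a face-vanishing `k`-family (`k ≤ 6`) plus a member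
containing all of it satisfies `C_{k+1}` at every `p` and the pointwise master conjecture at every interior `p`** — the first order-seven instances.
HONEST FRAMING: `C_k`, `MasterFamilyEqIff k` (k ≥ 3) remain OPEN in general.  Axioms standard. [this work]
-/

noncomputable section

open scoped Classical

namespace Summit.CriticalPhenomena.PercolationContinuityZ3.Theorems

open Finset Function
open Literature.Combinatorics.Sahi2008
open Literature.Probability.Percolation (DeterminedBy)
open Literature.Probability.Percolation.DecisionTree (ind)

namespace Pointwise

variable {ι : Type} [Fintype ι]

/-! ### 1. The transfer along an absorbing member (every `p`, every order `≥ 3`) -/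

/-- `E_{n+3}(μ_p; 1_U) = 0 ↔ E_{n+2}(μ_p; 1_{U_{−j}}) = 0` when `U_j` absorbs. [this work] -/
theorem sahiE_ind_eq_zero_iff_erase_of_absorbing (p : ι → unitInterval) {n : ℕ} (U : Fin (n + 3) → Set (Set ι)) (j : Fin (n + 3))
    (habs : ∀ l, l ≠ j → U l ⊆ U j) :
    sahiE (bernoulliWeight p) (n + 3) (fun i => ind (U i)) = 0 ↔
      sahiE (bernoulliWeight p) (n + 2) (fun i => ind (U (j.succAbove i))) = 0 := by
  rw [sahiE_ind_eq_of_absorbing (bernoulliWeight p) (n := n + 1) U j habs]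
  refine ⟨fun h => (mul_eq_zero.1 h).resolve_left (absorbing_factor_pos p (U j) n).ne', fun h => by rw [h, mul_zero]⟩

/-- `E_{n+3}(μ_p; 1_U) ≥ 0 ↔ E_{n+2}(μ_p; 1_{U_{−j}}) ≥ 0` when `U_j` absorbs. [this work] -/
theorem sahiE_ind_nonneg_iff_erase_of_absorbing (p : ι → unitInterval) {n : ℕ} (U : Fin (n + 3) → Set (Set ι)) (j : Fin (n + 3))
    (habs : ∀ l, l ≠ j → U l ⊆ U j) :
    0 ≤ sahiE (bernoulliWeight p) (n + 3) (fun i => ind (U i)) ↔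
      0 ≤ sahiE (bernoulliWeight p) (n + 2) (fun i => ind (U (j.succAbove i))) := by
  rw [sahiE_ind_eq_of_absorbing (bernoulliWeight p) (n := n + 1) U j habs]
  exact mul_nonneg_iff_of_pos_left (absorbing_factor_pos p (U j) n)

/-- `E_{n+3}(μ_p; 1_U) > 0 ↔ E_{n+2}(μ_p; 1_{U_{−j}}) > 0` when `U_j` absorbs. [this work] -/
theorem sahiE_ind_pos_iff_erase_of_absorbing (p : ι → unitInterval) {n : ℕ} (U : Fin (n + 3) → Set (Set ι)) (j : Fin (n + 3))
    (habs : ∀ l, l ≠ j → U l ⊆ U j) :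
    0 < sahiE (bernoulliWeight p) (n + 3) (fun i => ind (U i)) ↔
      0 < sahiE (bernoulliWeight p) (n + 2) (fun i => ind (U (j.succAbove i))) := by
  rw [sahiE_ind_eq_of_absorbing (bernoulliWeight p) (n := n + 1) U j habs]
  exact mul_pos_iff_of_pos_left (absorbing_factor_pos p (U j) n)

/-- **The pointwise statement transfers along an absorbing member**: for increasing `U` with `U_l ⊆ U_j` for all `l`, and any `p`,
`(E_{n+3}(μ_p;1_U) = 0 ↔ U ∈ Z_{n+3}) ↔ (E_{n+2}(μ_p;1_{U_{−j}}) = 0 ↔ U_{−j} ∈ Z_{n+2})`. [this work] -/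
theorem pointwise_iff_erase_of_absorbing (p : ι → unitInterval) {n : ℕ} (U : Fin (n + 3) → Set (Set ι)) (hU : ∀ i, IsUpperSet (U i))
    (j : Fin (n + 3)) (habs : ∀ l, l ≠ j → U l ⊆ U j) :
    (sahiE (bernoulliWeight p) (n + 3) (fun i => ind (U i)) = 0 ↔ SuppZeroFlag (n + 3) U) ↔
      (sahiE (bernoulliWeight p) (n + 2) (fun i => ind (U (j.succAbove i))) = 0 ↔
        SuppZeroFlag (n + 2) (fun i => U (j.succAbove i))) := by
  rw [sahiE_ind_eq_zero_iff_erase_of_absorbing p U j habs, suppZeroFlag_iff_erase_of_absorbing U hU j habs]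

/-! ### 2. Absorbing extensions of face-vanishing families of order `≤ 6` (orders up to seven) -/

/-- **`C_{k+1}` for an absorbing extension of a face-vanishing `k`-family, `k ≤ 6`** (every `p`). [this work] -/
theorem sahiE_ind_nonneg_of_absorbing_faceVanishing_of_le_six {n : ℕ} (hn : n + 2 ≤ 6) (p : ι → unitInterval)
    (U : Fin (n + 3) → Set (Set ι)) (hU : ∀ i, IsUpperSet (U i)) (j : Fin (n + 3)) (habs : ∀ l, l ≠ j → U l ⊆ U j)
    (S : Finset ι) (hUS : ∀ i, DeterminedBy (U (j.succAbove i)) (↑S : Set ι))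
    (hall : ∀ e ∈ S, ∀ b : Bool, SuppZeroFlag (n + 2) (fun i => secAt e b (U (j.succAbove i)))) :
    0 ≤ sahiE (bernoulliWeight p) (n + 3) (fun i => ind (U i)) :=
  (sahiE_ind_nonneg_iff_erase_of_absorbing p U j habs).2
    (sahiE_ind_nonneg_of_faceVanishing_of_le_six hn p (fun i => U (j.succAbove i)) S (fun _ => hU _) hUS hall)

/-- **Pointwise master conjecture for an absorbing extension of a face-vanishing `k`-family, `k ≤ 6`**: at every interior `p`,
`E_{k+1}(μ_p; 1_U) = 0 ↔ U ∈ Z_{k+1}` — in particular for SEVEN events `U_0, …, U_6` with `U_6 ⊇ U_l` and `(U_0,…,U_5)` face-vanishing. [this work] -/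
theorem sahiE_ind_eq_zero_iff_of_absorbing_faceVanishing_of_le_six {n : ℕ} (hn : n + 2 ≤ 6) (p : ι → unitInterval)
    (hp : ∀ e, (p e : ℝ) ∈ Set.Ioo (0 : ℝ) 1) (U : Fin (n + 3) → Set (Set ι)) (hU : ∀ i, IsUpperSet (U i)) (j : Fin (n + 3))
    (habs : ∀ l, l ≠ j → U l ⊆ U j) (S : Finset ι) (hUS : ∀ i, DeterminedBy (U (j.succAbove i)) (↑S : Set ι))
    (hall : ∀ e ∈ S, ∀ b : Bool, SuppZeroFlag (n + 2) (fun i => secAt e b (U (j.succAbove i)))) :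
    sahiE (bernoulliWeight p) (n + 3) (fun i => ind (U i)) = 0 ↔ SuppZeroFlag (n + 3) U :=
  (pointwise_iff_erase_of_absorbing p U hU j habs).2
    (sahiE_ind_eq_zero_iff_of_faceVanishing_of_le_six hn p hp (fun i => U (j.succAbove i)) S (fun _ => hU _) hUS hall)

/-- Strict form: such an extension outside `Z_{k+1}` has `E_{k+1}(μ_p; 1_U) > 0` at every interior `p`. [this work] -/
theorem sahiE_ind_pos_of_absorbing_faceVanishing_of_le_six {n : ℕ} (hn : n + 2 ≤ 6) (p : ι → unitInterval)
    (hp : ∀ e, (p e : ℝ) ∈ Set.Ioo (0 : ℝ) 1) (U : Fin (n + 3) → Set (Set ι)) (hU : ∀ i, IsUpperSet (U i)) (j : Fin (n + 3))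
    (habs : ∀ l, l ≠ j → U l ⊆ U j) (S : Finset ι) (hUS : ∀ i, DeterminedBy (U (j.succAbove i)) (↑S : Set ι))
    (hall : ∀ e ∈ S, ∀ b : Bool, SuppZeroFlag (n + 2) (fun i => secAt e b (U (j.succAbove i)))) (hZ : ¬ SuppZeroFlag (n + 3) U) :
    0 < sahiE (bernoulliWeight p) (n + 3) (fun i => ind (U i)) :=
  lt_of_le_of_ne (sahiE_ind_nonneg_of_absorbing_faceVanishing_of_le_six hn p U hU j habs S hUS hall)
    (fun h0 => hZ ((sahiE_ind_eq_zero_iff_of_absorbing_faceVanishing_of_le_six hn p hp U hU j habs S hUS hall).1 h0.symm))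

/-! ### 3. Absorbing TOWERS: iterating the transfer -/

/-- **Chaining form** (for towers of absorbing members over a settled family, applied repeatedly): if `U_j` absorbs and the pointwise statement holds
for `U_{−j}` at `p`, it holds for `U` at `p`. [this work] -/
theorem pointwise_of_erase_of_absorbing (p : ι → unitInterval) {n : ℕ} (U : Fin (n + 3) → Set (Set ι)) (hU : ∀ i, IsUpperSet (U i))
    (j : Fin (n + 3)) (habs : ∀ l, l ≠ j → U l ⊆ U j)
    (h : sahiE (bernoulliWeight p) (n + 2) (fun i => ind (U (j.succAbove i))) = 0 ↔ SuppZeroFlag (n + 2) (fun i => U (j.succAbove i))) :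
    sahiE (bernoulliWeight p) (n + 3) (fun i => ind (U i)) = 0 ↔ SuppZeroFlag (n + 3) U :=
  (pointwise_iff_erase_of_absorbing p U hU j habs).2 h

/-- The same for non-negativity: `C` one order down for `U_{−j}` at `p` gives `C` for `U` at `p`. [this work] -/
theorem nonneg_of_erase_of_absorbing (p : ι → unitInterval) {n : ℕ} (U : Fin (n + 3) → Set (Set ι)) (j : Fin (n + 3))
    (habs : ∀ l, l ≠ j → U l ⊆ U j) (h : 0 ≤ sahiE (bernoulliWeight p) (n + 2) (fun i => ind (U (j.succAbove i)))) :
    0 ≤ sahiE (bernoulliWeight p) (n + 3) (fun i => ind (U i)) :=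
  (sahiE_ind_nonneg_iff_erase_of_absorbing p U j habs).2 h

end Pointwise

end Summit.CriticalPhenomena.PercolationContinuityZ3.Theorems
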